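import Mathlib
import Summits.MatrixMultiplication.Statement
import Summits.MatrixMultiplication.MatrixMultiplication.Theorems.GraphEquationsPureFormsNec

/-!
# The bilinear syzygies of the product matrix are Koszul for `n ≥ 3` (`GraphEquations`, M36)

Decomp-mm node «GraphEquations» (lens 5 «finite range + asymptotic regime + bridge», g38); attacked
leaf `MultiplicityReduction` (stmt-MatrixMultiplication-27806).  Target of the node, VERBATIM:
`_root_.MatrixMultiplication`.  Route-neutral (`closes` unchanged); imports no `Theses/` file.

THE STRUCTURE LEMMA BEHIND RUNG 3 OF THE DEGREE LADDER (critic g17 ask (2)).  Write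
`φ_q = Σ_k a_{q₁k} b_{kq₂}` for the entries of `AB`.  A *bilinear syzygy* of `φ` is a family
`β_q = Σ_{v,t} Bc(q,v,t)·a_v b_t` with `Σ_q β_q φ_q = 0`; it is KOSZUL if `β_q = Σ_{q'} Λ_{qq'} φ_{q'}`
with `Λ` antisymmetric, i.e. `Bc(q,(p,k),(l,r)) = [k = l]·Λ_{q,(p,r)}`.
* `bilinear_syzygy_eq` — the coefficient equations of a bilinear syzygy (all `n`; polarize the
  biquadratic identity and evaluate at elementary matrices): for all `i j p k l r m`,
  `Bc((i,j),(p,k),(l,r)) + [k=m]Bc((p,j),(i,m),(l,r)) + [m=l]Bc((i,r),(p,k),(m,j)) + [k=l]Bc((p,r),(i,m),(m,j)) = 0`.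
* `isKoszul_of_bilinear_syzygy` — **for `n ≥ 3` every bilinear syzygy of `φ` is Koszul**: for
  `k ≠ l` a FREE INDEX `m ∉ {k,l}` kills all bracket terms; for `k = l`, `m ≠ k` gives
  `Bc((i,j),(p,k),(k,r)) = −Bc((p,r),(i,m),(m,j))` (independent of `k`, antisymmetric).
  `exists_bilinear_syzygy_not_koszul_two` — SHARP: at `n = 2` the adjugate relation
  `(adj A·AB·adj B)₀₁ = 0` is a non-Koszul bilinear syzygy (census NODE-g37 §3a: `9 = 6 + 3`).
  Instruments: `g37/syz2_koszul_n.py` (`3 ≤ n ≤ 8`), `g38/check_E.py` (the equations alone give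
  `9, 36, 120` at `n = 2, 3, 4`) — now a theorem for all `n ≥ 3`.
* `isBilinearSyzygy_of_poly` / `poly_of_isBilinearSyzygy` — bridge to the identity in `ℂ[A,B,C]`;
  `sum_betaPoly_mul_generator_eq` — CONSEQUENCE (`n ≥ 3`): if `Σ_q β_q φ_q = 0` then
  `Σ_q β_q f_q = Σ_q (Σ_{q'} Λ_{qq'} c_{q'}) f_q ∈ ℂ[c]₁·⟨f⟩` (antisymmetry kills `Σ Λ_{qq'} f_{q'} f_q`):
  the `(1,1)`-block of the cubic normal form `I(W_n)_{≤3} = ℂ[u,c]_{≤1}·⟨f⟩` (NODE-g38 §2).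
Strictly weaker than the summit: commutative algebra of the generic product matrix at fixed `n`;
no cost, no exponent.  No `sorry`.  Sources: [BurgisserClausenShokrollahi1997, Problem 16.3],
[DeConciniStrickland1981] (variety of complexes; not used — the proof here is elementary).
-/

set_option linter.dupNamespace false

noncomputable section

namespace Summit.MatrixMultiplication.MatrixMultiplication.Theorems.GraphEquations

open MvPolynomial

variable {n : ℕ}

/-! ## Bilinear families, evaluated -/

/-- The coefficient tensor type of a bilinear family `β_q = Σ_{v,t} Bc q v t · a_v b_t`. -/
abbrev BilCoeff (n : ℕ) : Type := (Fin n × Fin n) → (Fin n × Fin n) → (Fin n × Fin n) → ℂ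

/-- `β_q(A,B) = Σ_{v,t} Bc q v t · A_v · B_t`. -/
def bilEval (Bc : BilCoeff n) (q : Fin n × Fin n) (A B : Fin n × Fin n → ℂ) : ℂ :=
  ∑ v : Fin n × Fin n, ∑ t : Fin n × Fin n, Bc q v t * A v * B t

/-- `(AB)_q = Σ_k A_{q₁k} B_{kq₂}`. -/
def prodEntry (q : Fin n × Fin n) (A B : Fin n × Fin n → ℂ) : ℂ :=
  ∑ k : Fin n, A (q.1, k) * B (k, q.2)

/-- The biquadratic form `Σ_q β_q(A,B)·(AB)_q`. -/
def syzEval (Bc : BilCoeff n) (A B : Fin n × Fin n → ℂ) : ℂ :=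
  ∑ q : Fin n × Fin n, bilEval Bc q A B * prodEntry q A B

/-- `Bc` is (the coefficient tensor of) a BILINEAR SYZYGY of `φ = AB`:
`Σ_q β_q(A,B)·(AB)_q = 0` for all `A, B`. -/
def IsBilinearSyzygy (Bc : BilCoeff n) : Prop :=
  ∀ A B : Fin n × Fin n → ℂ, syzEval Bc A B = 0

/-- `Bc` is KOSZUL: `β_q = Σ_{q'} Λ_{qq'} φ_{q'}` with `Λ` antisymmetric, i.e.
`Bc q (p,k) (l,r) = [k = l]·Λ q (p,r)`. -/
def IsKoszul (Bc : BilCoeff n) : Prop :=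
  ∃ Λ : (Fin n × Fin n) → (Fin n × Fin n) → ℂ, (∀ q q', Λ q q' = -Λ q' q) ∧
    ∀ q v t, Bc q v t = if v.2 = t.1 then Λ q (v.1, t.2) else 0

/-! ## Polarization -/

/-- The full polarization of `syzEval` (bilinear in each of `A, A', B, B'`). -/
def polarEval (Bc : BilCoeff n) (A A' B B' : Fin n × Fin n → ℂ) : ℂ :=
  ∑ q : Fin n × Fin n, (bilEval Bc q A B * prodEntry q A' B' + bilEval Bc q A B' * prodEntry q A' B +
    bilEval Bc q A' B * prodEntry q A B' + bilEval Bc q A' B' * prodEntry q A B)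

/-- `β_q` is additive in `A`. -/
theorem bilEval_add_left (Bc : BilCoeff n) (q : Fin n × Fin n) (A A' B : Fin n × Fin n → ℂ) :
    bilEval Bc q (A + A') B = bilEval Bc q A B + bilEval Bc q A' B := by
  simp only [bilEval, Pi.add_apply, ← Finset.sum_add_distrib]
  refine Finset.sum_congr rfl fun v _ => Finset.sum_congr rfl fun t _ => by ring

/-- `β_q` is additive in `B`. -/
theorem bilEval_add_right (Bc : BilCoeff n) (q : Fin n × Fin n) (A B B' : Fin n × Fin n → ℂ) :
    bilEval Bc q A (B + B') = bilEval Bc q A B + bilEval Bc q A B' := by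
  simp only [bilEval, Pi.add_apply, ← Finset.sum_add_distrib]
  refine Finset.sum_congr rfl fun v _ => Finset.sum_congr rfl fun t _ => by ring

/-- `(AB)_q` is additive in `A`. -/
theorem prodEntry_add_left (q : Fin n × Fin n) (A A' B : Fin n × Fin n → ℂ) :
    prodEntry q (A + A') B = prodEntry q A B + prodEntry q A' B := by
  simp only [prodEntry, Pi.add_apply, ← Finset.sum_add_distrib]
  refine Finset.sum_congr rfl fun k _ => by ring

/-- `(AB)_q` is additive in `B`. -/
theorem prodEntry_add_right (q : Fin n × Fin n) (A B B' : Fin n × Fin n → ℂ) :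
    prodEntry q A (B + B') = prodEntry q A B + prodEntry q A B' := by
  simp only [prodEntry, Pi.add_apply, ← Finset.sum_add_distrib]
  refine Finset.sum_congr rfl fun k _ => by ring

/-- Inclusion–exclusion: the polarization is a signed sum of nine values of the biquadratic form. -/
theorem polarEval_eq (Bc : BilCoeff n) (A A' B B' : Fin n × Fin n → ℂ) :
    polarEval Bc A A' B B' =
      syzEval Bc (A + A') (B + B') - syzEval Bc A (B + B') - syzEval Bc A' (B + B')
        - syzEval Bc (A + A') B - syzEval Bc (A + A') B'
        + syzEval Bc A B + syzEval Bc A B' + syzEval Bc A' B + syzEval Bc A' B' := by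
  simp only [polarEval, syzEval, bilEval_add_left, bilEval_add_right, prodEntry_add_left,
    prodEntry_add_right, ← Finset.sum_sub_distrib, ← Finset.sum_add_distrib]
  exact Finset.sum_congr rfl fun q _ => by ring

/-- A bilinear syzygy has vanishing polarization. -/
theorem polarEval_eq_zero {Bc : BilCoeff n} (h : IsBilinearSyzygy Bc)
    (A A' B B' : Fin n × Fin n → ℂ) : polarEval Bc A A' B B' = 0 := by
  have h' : ∀ A B, syzEval Bc A B = 0 := h
  rw [polarEval_eq]
  simp only [h', add_zero, sub_self]

/-! ## Evaluation at elementary matrices: the coefficient equations -/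

/-- The elementary matrix `E_v` as a coordinate function. -/
def unitMat (v : Fin n × Fin n) : Fin n × Fin n → ℂ := fun w => if w = v then 1 else 0

/-- Entries of `E_v`. -/
@[simp] theorem unitMat_apply (v w : Fin n × Fin n) : unitMat v w = if w = v then 1 else 0 := rfl

/-- `β_q(E_u, E_s) = Bc q u s`. -/
theorem bilEval_unitMat (Bc : BilCoeff n) (q u s : Fin n × Fin n) :
    bilEval Bc q (unitMat u) (unitMat s) = Bc q u s := by
  classical
  simp only [bilEval, unitMat_apply, mul_ite, mul_one, mul_zero]
  simp only [Finset.sum_ite_eq', Finset.mem_univ, if_true]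

/-- `(E_x E_z)_q = [x₂ = z₁]·[q = (x₁, z₂)]`. -/
theorem prodEntry_unitMat (q x z : Fin n × Fin n) :
    prodEntry q (unitMat x) (unitMat z) = if q = (x.1, z.2) ∧ x.2 = z.1 then 1 else 0 := by
  classical
  obtain ⟨q₁, q₂⟩ := q
  obtain ⟨x₁, x₂⟩ := x
  obtain ⟨z₁, z₂⟩ := z
  simp only [prodEntry, unitMat_apply, Prod.mk.injEq, mul_ite, mul_one, mul_zero]
  by_cases h1 : q₁ = x₁ <;> by_cases h2 : q₂ = z₂ <;> simp [h1, h2, eq_comm]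

/-- `Σ_q f(q)·[q = c ∧ P] = [P]·f(c)`. -/
theorem sum_mul_ite_eq_and (f : Fin n × Fin n → ℂ) (c : Fin n × Fin n) (P : Prop) [Decidable P] :
    (∑ q : Fin n × Fin n, f q * if q = c ∧ P then 1 else 0) = if P then f c else 0 := by
  classical
  by_cases hP : P
  · simp only [hP, and_true, if_true, mul_ite, mul_one, mul_zero, Finset.sum_ite_eq',
      Finset.mem_univ]
  · simp [hP]

/-- **The coefficient equations of a bilinear syzygy** (all `n`): for all `i j p k l r m`,
`Bc((i,j),(p,k),(l,r)) + [k=m] Bc((p,j),(i,m),(l,r)) + [m=l] Bc((i,r),(p,k),(m,j))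
 + [k=l] Bc((p,r),(i,m),(m,j)) = 0`. -/
theorem bilinear_syzygy_eq {Bc : BilCoeff n} (h : IsBilinearSyzygy Bc) (i j p k l r m : Fin n) :
    Bc (i, j) (p, k) (l, r) + (if k = m then Bc (p, j) (i, m) (l, r) else 0)
      + (if m = l then Bc (i, r) (p, k) (m, j) else 0)
      + (if k = l then Bc (p, r) (i, m) (m, j) else 0) = 0 := by
  classical
  have hP := polarEval_eq_zero h (unitMat (i, m)) (unitMat (p, k)) (unitMat (m, j)) (unitMat (l, r))
  simp only [polarEval, bilEval_unitMat, prodEntry_unitMat, Finset.sum_add_distrib,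
    sum_mul_ite_eq_and] at hP
  simp only [if_true] at hP
  -- hP : [k=l] Bc(p,r)(i,m)(m,j) + [k=m] Bc(p,j)(i,m)(l,r) + [m=l] Bc(i,r)(p,k)(m,j) + Bc(i,j)(p,k)(l,r) = 0
  linear_combination hP

/-! ## `n ≥ 3`: every bilinear syzygy is Koszul -/

/-- With three indices available there is a free index avoiding any two. -/
theorem exists_ne_ne (hn : 3 ≤ n) (k l : Fin n) : ∃ m : Fin n, m ≠ k ∧ m ≠ l := by
  classical
  have hlt : ({k, l} : Finset (Fin n)).card < (Finset.univ : Finset (Fin n)).card := by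
    rw [Finset.card_univ, Fintype.card_fin]
    exact lt_of_le_of_lt Finset.card_le_two (by omega)
  obtain ⟨m, -, hm⟩ := Finset.exists_mem_notMem_of_card_lt_card hlt
  exact ⟨m, fun h => hm (by simp [h]), fun h => hm (by simp [h])⟩

/-- Off the diagonal `k ≠ l` the coefficients vanish (`n ≥ 3`). -/
theorem bilinear_syzygy_offDiag (hn : 3 ≤ n) {Bc : BilCoeff n} (h : IsBilinearSyzygy Bc)
    (q : Fin n × Fin n) (p k l r : Fin n) (hkl : k ≠ l) : Bc q (p, k) (l, r) = 0 := by
  obtain ⟨m, hmk, hml⟩ := exists_ne_ne hn k l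
  obtain ⟨i, j⟩ := q
  have hE := bilinear_syzygy_eq h i j p k l r m
  rw [if_neg (Ne.symm hmk), if_neg hml, if_neg hkl] at hE
  simpa using hE

/-- On the diagonal, the transposition rule `Bc((i,j),(p,k),(k,r)) = −Bc((p,r),(i,m),(m,j))` for
every `m ≠ k` (all `n`). -/
theorem bilinear_syzygy_diag {Bc : BilCoeff n} (h : IsBilinearSyzygy Bc) (i j p k r m : Fin n)
    (hmk : m ≠ k) : Bc (i, j) (p, k) (k, r) = -Bc (p, r) (i, m) (m, j) := by
  have hE := bilinear_syzygy_eq h i j p k k r m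
  rw [if_neg (Ne.symm hmk), if_neg hmk, if_pos rfl] at hE
  linear_combination hE

/-- The diagonal value does not depend on the diagonal index (`n ≥ 3`). -/
theorem bilinear_syzygy_diag_const (hn : 3 ≤ n) {Bc : BilCoeff n} (h : IsBilinearSyzygy Bc)
    (i j p r k k' : Fin n) : Bc (i, j) (p, k) (k, r) = Bc (i, j) (p, k') (k', r) := by
  obtain ⟨m, hmk, hmk'⟩ := exists_ne_ne hn k k'
  rw [bilinear_syzygy_diag h i j p k r m hmk, bilinear_syzygy_diag h i j p k' r m hmk']

/-- **For `n ≥ 3` every bilinear syzygy of `φ = AB` is Koszul.** -/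
theorem isKoszul_of_bilinear_syzygy (hn : 3 ≤ n) {Bc : BilCoeff n} (h : IsBilinearSyzygy Bc) :
    IsKoszul Bc := by
  have h0 : 0 < n := by omega
  have h1 : 1 < n := by omega
  let z : Fin n := ⟨0, h0⟩
  let o : Fin n := ⟨1, h1⟩
  have hoz : o ≠ z := by simp [o, z, Fin.ext_iff]
  refine ⟨fun q q' => Bc q (q'.1, z) (z, q'.2), fun q q' => ?_, fun q v t => ?_⟩
  · obtain ⟨i, j⟩ := q
    obtain ⟨p, r⟩ := q'
    simp only
    rw [bilinear_syzygy_diag h i j p z r o hoz, bilinear_syzygy_diag_const hn h p r i j o z]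
  · obtain ⟨p, k⟩ := v
    obtain ⟨l, r⟩ := t
    simp only
    split_ifs with hkl
    · subst hkl
      exact bilinear_syzygy_diag_const hn h q.1 q.2 p r k z
    · exact bilinear_syzygy_offDiag hn h q p k l r hkl

/-- An antisymmetric double sum over a `ℂ`-module vanishes. -/
theorem sum_sum_eq_zero_of_antisymm {M : Type*} [AddCommGroup M] [Module ℂ M] {ι : Type*}
    [Fintype ι] (F : ι → ι → M) (hF : ∀ a b, F a b = -F b a) : ∑ a, ∑ b, F a b = 0 := by
  have hswap : ∑ a, ∑ b, F a b = -∑ a, ∑ b, F a b := by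
    conv_lhs => rw [Finset.sum_comm]
    simp only [← Finset.sum_neg_distrib]
    exact Finset.sum_congr rfl fun a _ => Finset.sum_congr rfl fun b _ => hF b a
  have h2 : (2 : ℂ) • ∑ a, ∑ b, F a b = 0 := by
    rw [two_smul]; exact eq_neg_iff_add_eq_zero.1 hswap
  exact (smul_eq_zero.1 h2).resolve_left two_ne_zero

/-- `Σ_t [a = t₁]·G(t) = Σ_r G(a, r)`. -/
theorem sum_ite_eq_fst {M : Type*} [AddCommMonoid M] (a : Fin n) (G : Fin n × Fin n → M) :
    (∑ t : Fin n × Fin n, if a = t.1 then G t else 0) = ∑ r : Fin n, G (a, r) := by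
  classical
  rw [Fintype.sum_prod_type, Finset.sum_comm]
  exact Finset.sum_congr rfl fun r _ => by simp only [Finset.sum_ite_eq, Finset.mem_univ, if_true]

/-- A Koszul family evaluates to `β_q(A,B) = Σ_{q'} Λ_{qq'} (AB)_{q'}`. -/
theorem bilEval_of_koszul {Bc : BilCoeff n} {Λ : (Fin n × Fin n) → (Fin n × Fin n) → ℂ}
    (hBc : ∀ q v t, Bc q v t = if v.2 = t.1 then Λ q (v.1, t.2) else 0)
    (q : Fin n × Fin n) (A B : Fin n × Fin n → ℂ) :
    bilEval Bc q A B = ∑ q' : Fin n × Fin n, Λ q q' * prodEntry q' A B := by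
  classical
  have h1 : bilEval Bc q A B =
      ∑ v : Fin n × Fin n, ∑ r : Fin n, Λ q (v.1, r) * A v * B (v.2, r) := by
    simp only [bilEval, hBc, ite_mul, zero_mul, sum_ite_eq_fst]
  rw [h1, Fintype.sum_prod_type, Fintype.sum_prod_type]
  refine Finset.sum_congr rfl fun p _ => ?_
  simp only [prodEntry, Finset.mul_sum]
  rw [Finset.sum_comm]
  exact Finset.sum_congr rfl fun r _ => Finset.sum_congr rfl fun k _ => by ring

/-- The converse: Koszul families are bilinear syzygies (all `n`). -/
theorem bilinear_syzygy_of_isKoszul {Bc : BilCoeff n} (h : IsKoszul Bc) : IsBilinearSyzygy Bc := by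
  obtain ⟨Λ, hanti, hBc⟩ := h
  intro A B
  simp only [syzEval, bilEval_of_koszul hBc, Finset.sum_mul]
  exact sum_sum_eq_zero_of_antisymm _ fun q q' => by rw [hanti q q']; ring

/-! ## Sharpness at `n = 2`: the adjugate syzygy is bilinear and not Koszul -/

/-- Row `0` of `adj A` at `n = 2` as coefficient vectors: `(a₁₁, −a₀₁)`. -/
def adjRowZero : Fin 2 → (Fin 2 × Fin 2 → ℂ) := ![unitMat (1, 1), -unitMat (0, 1)]

/-- Column `1` of `adj B` at `n = 2` as coefficient vectors: `(−b₀₁, b₀₀)ᵀ`. -/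
def adjColOne : Fin 2 → (Fin 2 × Fin 2 → ℂ) := ![-unitMat (0, 1), unitMat (0, 0)]

/-- The `(0,1)` entry of the adjugate identity `adj(A)·AB·adj(B) = det A det B·𝟙` as a bilinear
family: `β_{(s,t)} = adj(A)_{0s} · adj(B)_{t1}`. -/
def adjSyz : BilCoeff 2 := fun q v t => adjRowZero q.1 v * adjColOne q.2 t

/-- The adjugate family is a bilinear syzygy of `φ` at `n = 2` … -/
theorem adjSyz_isBilinearSyzygy : IsBilinearSyzygy adjSyz := by
  intro A B
  simp [syzEval, bilEval, prodEntry, adjSyz, adjRowZero, adjColOne, Fintype.sum_prod_type,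
    Fin.sum_univ_two]
  ring

/-- … and it is not Koszul (`Bc((0,0),(1,1),(0,1)) = −1 ≠ 0` off the diagonal): the hypothesis
`3 ≤ n` of `isKoszul_of_bilinear_syzygy` is sharp. -/
theorem adjSyz_not_isKoszul : ¬ IsKoszul adjSyz := by
  rintro ⟨Λ, -, hBc⟩
  have h := hBc (0, 0) (1, 1) (0, 1)
  simp [adjSyz, adjRowZero, adjColOne] at h

/-- Sharpness of `3 ≤ n`: a non-Koszul bilinear syzygy exists at `n = 2`. -/
theorem exists_bilinear_syzygy_not_koszul_two :
    ∃ Bc : BilCoeff 2, IsBilinearSyzygy Bc ∧ ¬ IsKoszul Bc :=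
  ⟨adjSyz, adjSyz_isBilinearSyzygy, adjSyz_not_isKoszul⟩

/-! ## From the polynomial identity to the evaluated form, and the consequence for `Σ β_q f_q` -/

/-- `a_v` as an element of `ℂ[A,B,C]`. -/
abbrev xA (v : Fin n × Fin n) : MvPolynomial (GraphVars n) ℂ := X (Sum.inl (Sum.inl v))
/-- `b_t` as an element of `ℂ[A,B,C]`. -/
abbrev xB (t : Fin n × Fin n) : MvPolynomial (GraphVars n) ℂ := X (Sum.inl (Sum.inr t))
/-- `c_q` as an element of `ℂ[A,B,C]`. -/
abbrev xC (q : Fin n × Fin n) : MvPolynomial (GraphVars n) ℂ := X (Sum.inr q)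

/-- The bilinear family as polynomials: `β_q = Σ_{v,t} Bc q v t · a_v b_t`. -/
def betaPoly (Bc : BilCoeff n) (q : Fin n × Fin n) : MvPolynomial (GraphVars n) ℂ :=
  ∑ v : Fin n × Fin n, ∑ t : Fin n × Fin n, C (Bc q v t) * xA v * xB t

/-- `φ_q = Σ_k a_{q₁k} b_{kq₂}` (so that `f_q = c_q − φ_q`). -/
def phiPoly (n : ℕ) (q : Fin n × Fin n) : MvPolynomial (GraphVars n) ℂ :=
  ∑ k : Fin n, xA (q.1, k) * xB (k, q.2)

/-- `f_q = c_q − φ_q`. -/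
theorem generator_eq_xC_sub_phiPoly (q : Fin n × Fin n) : generator n q = xC q - phiPoly n q := rfl

/-- The point `(A, B, 0)`. -/
def abPoint (A B : Fin n × Fin n → ℂ) : GraphVars n → ℂ := Sum.elim (Sum.elim A B) fun _ => 0

/-- `a`-coordinates of `(A, B, 0)`. -/
@[simp] theorem abPoint_a (A B : Fin n × Fin n → ℂ) (v : Fin n × Fin n) :
    abPoint A B (Sum.inl (Sum.inl v)) = A v := rfl
/-- `b`-coordinates of `(A, B, 0)`. -/
@[simp] theorem abPoint_b (A B : Fin n × Fin n → ℂ) (t : Fin n × Fin n) :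
    abPoint A B (Sum.inl (Sum.inr t)) = B t := rfl

/-- `β_q(A, B, 0) = β_q(A,B)`. -/
theorem eval_abPoint_betaPoly (Bc : BilCoeff n) (q : Fin n × Fin n) (A B : Fin n × Fin n → ℂ) :
    eval (abPoint A B) (betaPoly Bc q) = bilEval Bc q A B := by
  simp [betaPoly, bilEval, map_sum]

/-- `φ_q(A, B, 0) = (AB)_q`. -/
theorem eval_abPoint_phiPoly (q : Fin n × Fin n) (A B : Fin n × Fin n → ℂ) :
    eval (abPoint A B) (phiPoly n q) = prodEntry q A B := by
  simp [phiPoly, prodEntry, map_sum]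

/-- **Bridge**: a polynomial identity `Σ_q β_q φ_q = 0` in `ℂ[A,B,C]` makes `Bc` a bilinear syzygy. -/
theorem isBilinearSyzygy_of_poly {Bc : BilCoeff n}
    (h : ∑ q : Fin n × Fin n, betaPoly Bc q * phiPoly n q = 0) : IsBilinearSyzygy Bc := by
  intro A B
  have := congrArg (eval (abPoint A B)) h
  simpa [map_sum, map_mul, eval_abPoint_betaPoly, eval_abPoint_phiPoly, syzEval] using this

/-- Conversely a bilinear syzygy is a polynomial identity (polynomials over `ℂ` are functions). -/
theorem poly_of_isBilinearSyzygy {Bc : BilCoeff n} (h : IsBilinearSyzygy Bc) :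
    ∑ q : Fin n × Fin n, betaPoly Bc q * phiPoly n q = 0 := by
  apply MvPolynomial.funext
  intro x
  have hx : eval x (∑ q : Fin n × Fin n, betaPoly Bc q * phiPoly n q) =
      eval (abPoint (fun v => x (Sum.inl (Sum.inl v))) (fun t => x (Sum.inl (Sum.inr t))))
        (∑ q : Fin n × Fin n, betaPoly Bc q * phiPoly n q) := by
    simp [betaPoly, phiPoly, map_sum]
  rw [hx, map_zero]
  simpa [map_sum, map_mul, eval_abPoint_betaPoly, eval_abPoint_phiPoly, syzEval] using h _ _

/-- For a Koszul family, `β_q = Σ_{q'} Λ_{qq'} φ_{q'}` as polynomials. -/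
theorem betaPoly_eq_of_koszul {Bc : BilCoeff n} {Λ : (Fin n × Fin n) → (Fin n × Fin n) → ℂ}
    (hBc : ∀ q v t, Bc q v t = if v.2 = t.1 then Λ q (v.1, t.2) else 0) (q : Fin n × Fin n) :
    betaPoly Bc q = ∑ q' : Fin n × Fin n, C (Λ q q') * phiPoly n q' := by
  classical
  have h1 : betaPoly Bc q =
      ∑ v : Fin n × Fin n, ∑ r : Fin n, C (Λ q (v.1, r)) * xA v * xB (v.2, r) := by
    simp only [betaPoly, hBc, apply_ite C, map_zero, ite_mul, zero_mul, sum_ite_eq_fst]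
  rw [h1, Fintype.sum_prod_type, Fintype.sum_prod_type]
  refine Finset.sum_congr rfl fun p _ => ?_
  simp only [phiPoly, Finset.mul_sum]
  rw [Finset.sum_comm]
  exact Finset.sum_congr rfl fun r _ => Finset.sum_congr rfl fun k _ => by ring

/-- **Consequence (all `n`)**: for a Koszul family, `Σ_q β_q f_q = Σ_q (Σ_{q'} Λ_{qq'} c_{q'}) f_q`
— a `c`-LINEAR combination of the generators (`Σ_{q,q'} Λ_{qq'} f_{q'} f_q = 0` by antisymmetry). -/
theorem koszul_sum_mul_generator {Bc : BilCoeff n} {Λ : (Fin n × Fin n) → (Fin n × Fin n) → ℂ}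
    (hanti : ∀ q q', Λ q q' = -Λ q' q)
    (hBc : ∀ q v t, Bc q v t = if v.2 = t.1 then Λ q (v.1, t.2) else 0) :
    ∑ q : Fin n × Fin n, betaPoly Bc q * generator n q =
      ∑ q : Fin n × Fin n, (∑ q' : Fin n × Fin n, C (Λ q q') * xC q') * generator n q := by
  have hphi : ∀ q', phiPoly n q' = xC q' - generator n q' := fun q' => by
    rw [generator_eq_xC_sub_phiPoly]; ring
  simp only [betaPoly_eq_of_koszul hBc, hphi, mul_sub, Finset.sum_sub_distrib, sub_mul]
  -- the antisymmetric double sum vanishes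
  have hS : ∑ q : Fin n × Fin n, (∑ q' : Fin n × Fin n, C (Λ q q') * generator n q') * generator n q
      = 0 := by
    simp only [Finset.sum_mul]
    exact sum_sum_eq_zero_of_antisymm _ fun q q' => by rw [hanti q q', map_neg]; ring
  rw [hS, sub_zero]

/-- **The `(1,1)`-block of the cubic normal form (`n ≥ 3`).**  If `(β_q)` is a bilinear family with
`Σ_q β_q φ_q = 0` in `ℂ[A,B,C]`, then `Σ_q β_q f_q` is a `c`-linear combination of the generators:
`Σ_q β_q f_q = Σ_q L_q(c) f_q` with `L_q = Σ_{q'} Λ_{qq'} c_{q'}`, `Λ` antisymmetric. -/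
theorem sum_betaPoly_mul_generator_eq (hn : 3 ≤ n) {Bc : BilCoeff n}
    (h : ∑ q : Fin n × Fin n, betaPoly Bc q * phiPoly n q = 0) :
    ∃ Λ : (Fin n × Fin n) → (Fin n × Fin n) → ℂ, (∀ q q', Λ q q' = -Λ q' q) ∧
      ∑ q : Fin n × Fin n, betaPoly Bc q * generator n q =
        ∑ q : Fin n × Fin n, (∑ q' : Fin n × Fin n, C (Λ q q') * xC q') * generator n q := by
  obtain ⟨Λ, hanti, hBc⟩ := isKoszul_of_bilinear_syzygy hn (isBilinearSyzygy_of_poly h)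
  exact ⟨Λ, hanti, koszul_sum_mul_generator hanti hBc⟩

end Summit.MatrixMultiplication.MatrixMultiplication.Theorems.GraphEquations

end
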